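import Summits.AtomisticToContinuum.FouriersLaw.Theorems.EmbeddedDrudeMourreDrudeDissolutionStubForceWindowContinuity
import Summits.AtomisticToContinuum.FouriersLaw.Theorems.EmbeddedDrudeMourreDrudeDissolutionStubForceWindowPositivity
import Summits.AtomisticToContinuum.FouriersLaw.Theorems.EmbeddedDrudeMourreDrudeDissolutionStubForceWindowTransfer
import HarnessLib

/-!
# The force window, part IV: the pair sector has a continuous window density, positive at the threshold
(stub `stub_forceWindow` (KT) of line `gram-pencil-harmonic-chaos`, crux `EmbeddedDrudeMourre.DrudeDissolution`,
item stmt-AtomisticToContinuum-12593; `--supports` file, closes nothing)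

WHAT. For `ω₂ > 0` with the odd-sector gap of ALS's linearised phonon Boltzmann form
(`HasOddSectorGap ω₂ a b`) and a continuous kernel `G` on the pair shell `Shell 2 2` whose distance to the
rigid model `A·i·[sin]·Φ/∏ω` (`A ≠ 0`; `[sin] = sin c₀ + sin c₁ − sin a₀ − sin a₁`, `Φ` the combined quartic
vertex, `∏ω` the product of the four band energies) is controlled by the free frequency,
`‖G − A i [sin] Φ/∏ω‖ ≤ C |Ω₂₂|`, the push-forward of `|G|² σ₂₂` under `Ω₂₂ = sectorPhase ω₂` has on a
window `(−δ, δ)` a continuous density `ρ ≥ 0` with `ρ(0) > 0` (`forceWindow_pairSector`, registered helper;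
`forceWindow_pairSector_of`). This is the pair-sector input of stub KT: the hypothesis is clause (β) of
stub KΦ for `G = Σ_j c_j · wickKernel ω₂ 1 (f j) 2 2`.

HOW. Transport to the real cell `(−π,π]³` (`forceWindow_pairTransport`, part III): the weight becomes
`W(p) = |G(e(↑k₁,↑k₂,↑k₃))|²` and the hypothesis reads `‖G − T‖ ≤ C|Ω|` with the real model
`T = A i [sin] Φ/∏ω`, `|T|² = A²·W_sin` (`forceWindow_pair_hypothesis_real`, `forceWindow_norm_model_sq`).
Hence `W ≤ 2A²W_sin + 2C²Ω² ≤ C_W sin²((k₃−k₁)/2) sin²((k₂−k₃)/2)` by the bracket moduli of `sin`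
(`MourreDissolution.slabFibre_weight_le`) AND of the band `ω` (`Ω = [ω]` is itself a bracket:
`MourreDissolution.stub_bracketModulus` for the `C²` periodic `dispersion ω₂`), which feeds the generalised
threshold continuity of part I (`forceWindow_thresholdContinuous`); and
`|W − A²W_sin| ≤ C|Ω|(C|Ω| + 2|T|) ≤ C'|Ω|`, which feeds the positivity of part II
(`forceWindow_density_pos_of_window`). The factor `(2π)⁻³` of the transport rescales the density.
Elementary inequalities and measure plumbing; no cited facts.
-/

noncomputable section

namespace Summit.AtomisticToContinuum.FouriersLaw.Theorems.DrudeDissolution.GramPencilHarmonicChaos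

open MeasureTheory Filter Set Function Topology
open scoped InnerProductSpace ENNReal ComplexConjugate
open Literature.MathematicalPhysics.KineticTheory
open Literature.MathematicalPhysics.KineticTheory.HeatConduction
open Literature.MathematicalPhysics.KineticTheory.PhononBoltzmann
open HarmonicChaos ProbabilityTheory
open PinnedChainKinetic (𝕋 𝕋3 μ𝕋 μ𝕋3 k₄ sinT)
open scoped Literature.MathematicalPhysics.KineticTheory.HeatConduction.PinnedChainKinetic
open Summit.AtomisticToContinuum.FouriersLaw.Theorems.MourreDissolution

/-! ### Pointwise inequalities -/

/-- **Norms under a perturbation.** If `‖z − T‖ ≤ ε` then `|z|² ≤ 2|T|² + 2ε²` and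
`||z|² − |T|²| ≤ ε(ε + 2|T|)`. [folklore] -/
theorem forceWindow_norm_sq_bounds (z T : ℂ) {ε : ℝ} (h : ‖z - T‖ ≤ ε) :
    ‖z‖ ^ 2 ≤ 2 * ‖T‖ ^ 2 + 2 * ε ^ 2 ∧ |‖z‖ ^ 2 - ‖T‖ ^ 2| ≤ ε * (ε + 2 * ‖T‖) := by
  have hε : 0 ≤ ε := (norm_nonneg _).trans h
  have hd : |‖z‖ - ‖T‖| ≤ ε := (abs_norm_sub_norm_le z T).trans h
  have h1 : ‖z‖ ≤ ‖T‖ + ε := by linarith [(abs_le.1 hd).2]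
  constructor
  · nlinarith [norm_nonneg z, norm_nonneg T, sq_nonneg (‖T‖ - ε), mul_le_mul h1 h1 (norm_nonneg z) (by positivity)]
  · rw [show ‖z‖ ^ 2 - ‖T‖ ^ 2 = (‖z‖ - ‖T‖) * (‖z‖ + ‖T‖) by ring, abs_mul,
      abs_of_nonneg (by positivity : 0 ≤ ‖z‖ + ‖T‖)]
    calc |‖z‖ - ‖T‖| * (‖z‖ + ‖T‖) ≤ ε * (‖z‖ + ‖T‖) := by gcongr
      _ ≤ ε * (ε + 2 * ‖T‖) := mul_le_mul_of_nonneg_left (by linarith) hε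

/-- **The norm of the rigid model term**: `|A·i·x·v/P|² = A²·(v²/P²·x²)` for real `A, x, v, P`. [folklore] -/
theorem forceWindow_norm_model_sq (A x v P : ℝ) :
    ‖(A : ℂ) * Complex.I * (x : ℂ) * (v : ℂ) / (P : ℂ)‖ ^ 2 = A ^ 2 * (v ^ 2 / P ^ 2 * x ^ 2) := by
  rw [norm_div, norm_mul, norm_mul, norm_mul, Complex.norm_I, Complex.norm_real, Complex.norm_real,
    Complex.norm_real, Complex.norm_real, Real.norm_eq_abs, Real.norm_eq_abs, Real.norm_eq_abs,
    Real.norm_eq_abs, mul_one, div_pow, mul_pow, mul_pow, sq_abs, sq_abs, sq_abs, sq_abs]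
  ring

/-- **Bracket modulus of the resonance function**: `Ω = [ω]` is the collision bracket of the `2π`-periodic
`C²` band `ω`, so `|Ω(k₁,k₂,k₃)| ≤ K_ω |sin((k₃−k₁)/2) sin((k₂−k₃)/2)|` (`MourreDissolution.stub_bracketModulus`).
[folklore] -/
theorem forceWindow_resonanceFn_le {ω₂ : ℝ} (hω : 0 < ω₂) :
    ∃ K : ℝ, 0 ≤ K ∧ ∀ k₁ k₂ k₃ : ℝ,
      |resonanceFn ω₂ k₁ k₂ k₃| ≤ K * |Real.sin ((k₃ - k₁) / 2) * Real.sin ((k₂ - k₃) / 2)| := by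
  have hd : ContDiff ℝ 2 (dispersion ω₂) :=
    contDiff_iff_contDiffAt.2 fun k => (analyticAt_dispersion hω k).contDiffAt
  obtain ⟨K, hK0, hK⟩ := stub_bracketModulus (dispersion ω₂) (dispersion_periodic ω₂) hd
  exact ⟨K, hK0, fun k₁ k₂ k₃ => hK k₁ k₂ k₃⟩

/-! ### The pair hypothesis on real representatives -/

/-- **The rigid model at real representatives**: on `(↑x₁, ↑x₂, ↑x₃) ∈ 𝕋3` the model `A·i·[sinT]·Φ/∏ω` of
the circle vocabulary is the real model `A·i·[sin]·vertex/∏dispersion` of `LinearisedPhononCollisionOperator.lean`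
(`sinT_coe`, `bondVertex_coe`, `dispersion_coe`). [folklore] -/
theorem forceWindow_model_coe (ω₂ a b A : ℝ) (x₁ x₂ x₃ : ℝ) :
    (A : ℂ) * Complex.I *
        ((sinT (x₁ : 𝕋) + sinT (x₂ : 𝕋) - sinT (x₃ : 𝕋) - sinT ((x₁ : 𝕋) + (x₂ : 𝕋) - (x₃ : 𝕋)) : ℝ) : ℂ) *
        (PinnedChainKinetic.vertex a b ((x₁ : 𝕋), ((x₂ : 𝕋), (x₃ : 𝕋))) : ℂ) /
        ((PinnedChainKinetic.dispersion ω₂ (x₁ : 𝕋) * PinnedChainKinetic.dispersion ω₂ (x₂ : 𝕋) *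
          PinnedChainKinetic.dispersion ω₂ (x₃ : 𝕋) *
          PinnedChainKinetic.dispersion ω₂ ((x₁ : 𝕋) + (x₂ : 𝕋) - (x₃ : 𝕋)) : ℝ) : ℂ) =
      (A : ℂ) * Complex.I * ((Real.sin x₁ + Real.sin x₂ - Real.sin x₃ - Real.sin (x₁ + x₂ - x₃) : ℝ) : ℂ) *
        (vertex a b x₁ x₂ x₃ : ℂ) /
        ((dispersion ω₂ x₁ * dispersion ω₂ x₂ * dispersion ω₂ x₃ * dispersion ω₂ (x₁ + x₂ - x₃) : ℝ) : ℂ) := by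
  have h4 : ((x₁ : 𝕋) + (x₂ : 𝕋) - (x₃ : 𝕋)) = ((x₁ + x₂ - x₃ : ℝ) : 𝕋) := by
    rw [AddCircle.coe_sub, AddCircle.coe_add]
  have hv : PinnedChainKinetic.vertex a b ((x₁ : 𝕋), ((x₂ : 𝕋), (x₃ : 𝕋))) = vertex a b x₁ x₂ x₃ := by
    unfold PinnedChainKinetic.vertex
    rw [PinnedChainKinetic.bondVertex_coe]
    unfold vertex
    ring
  rw [h4, PinnedChainKinetic.sinT_coe, PinnedChainKinetic.sinT_coe, PinnedChainKinetic.sinT_coe,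
    PinnedChainKinetic.sinT_coe, hv, forceWindow_dispersion_coe, forceWindow_dispersion_coe,
    forceWindow_dispersion_coe, forceWindow_dispersion_coe]

/-- **The pair hypothesis at real representatives.** Read through the parametrisation `e` of the pair shell
at the lift `(↑k₁, ↑k₂, ↑k₃)` of `p = (k₁,(k₃,k₂))`, the shell hypothesis `‖G − A i [sinT] Φ/∏ω‖ ≤ C|Ω₂₂|`
becomes `‖G(e(ℓ p)) − A i [sin] vertex/∏dispersion‖ ≤ C |resonanceFn ω₂ k₁ k₂ k₃|`. [folklore] -/
theorem forceWindow_pair_hypothesis_real {ω₂ a b A C : ℝ} {G : Shell 2 2 → ℂ} {e : 𝕋3 → Shell 2 2}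
    (he : ∀ κ : 𝕋3, ((e κ : Shell 2 2) : SectorConfig 2 2).1 = ![κ.1, κ.2.1] ∧
      ((e κ : Shell 2 2) : SectorConfig 2 2).2 = ![κ.2.2, κ.1 + κ.2.1 - κ.2.2])
    (hβ : ∀ κ : Shell 2 2,
      ‖G κ - (A : ℂ) * Complex.I *
          ((sinT ((κ : SectorConfig 2 2).1 0) + sinT ((κ : SectorConfig 2 2).1 1) -
              sinT ((κ : SectorConfig 2 2).2 0) - sinT ((κ : SectorConfig 2 2).2 1) : ℝ) : ℂ) *
          (PinnedChainKinetic.vertex a b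
              ((κ : SectorConfig 2 2).1 0, (κ : SectorConfig 2 2).1 1, (κ : SectorConfig 2 2).2 0) : ℂ) /
          ((PinnedChainKinetic.dispersion ω₂ ((κ : SectorConfig 2 2).1 0) *
              PinnedChainKinetic.dispersion ω₂ ((κ : SectorConfig 2 2).1 1) *
              PinnedChainKinetic.dispersion ω₂ ((κ : SectorConfig 2 2).2 0) *
              PinnedChainKinetic.dispersion ω₂ ((κ : SectorConfig 2 2).2 1) : ℝ) : ℂ)‖ ≤
        C * |sectorPhase ω₂ κ|) (p : ℝ × ℝ × ℝ) :
    ‖G (e (((p.1 : ℝ) : 𝕋), (((p.2.2 : ℝ) : 𝕋), ((p.2.1 : ℝ) : 𝕋)))) -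
        (A : ℂ) * Complex.I *
          ((Real.sin p.1 + Real.sin p.2.2 - Real.sin p.2.1 - Real.sin (p.1 + p.2.2 - p.2.1) : ℝ) : ℂ) *
          (vertex a b p.1 p.2.2 p.2.1 : ℂ) /
          ((dispersion ω₂ p.1 * dispersion ω₂ p.2.2 * dispersion ω₂ p.2.1 * dispersion ω₂ (p.1 + p.2.2 - p.2.1) : ℝ) : ℂ)‖ ≤
      C * |resonanceFn ω₂ p.1 p.2.2 p.2.1| := by
  have h := hβ (e (((p.1 : ℝ) : 𝕋), (((p.2.2 : ℝ) : 𝕋), ((p.2.1 : ℝ) : 𝕋))))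
  obtain ⟨h1, h2⟩ := he (((p.1 : ℝ) : 𝕋), (((p.2.2 : ℝ) : 𝕋), ((p.2.1 : ℝ) : 𝕋)))
  simp only [h1, h2, Matrix.cons_val_zero, Matrix.cons_val_one,
    forceWindow_sectorPhase_pairShell ω₂ he, forceWindow_resonanceFn_coe] at h
  rwa [forceWindow_model_coe] at h

/-- Continuity of the pair-shell parametrisation from its coordinate description. [folklore] -/
theorem forceWindow_continuous_pairShell {e : 𝕋3 → Shell 2 2}
    (he : ∀ κ : 𝕋3, ((e κ : Shell 2 2) : SectorConfig 2 2).1 = ![κ.1, κ.2.1] ∧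
      ((e κ : Shell 2 2) : SectorConfig 2 2).2 = ![κ.2.2, κ.1 + κ.2.1 - κ.2.2]) : Continuous e := by
  refine continuous_induced_rng.2 ?_
  have hval : (Subtype.val ∘ e) = fun κ : 𝕋3 =>
      ((![κ.1, κ.2.1], ![κ.2.2, κ.1 + κ.2.1 - κ.2.2]) : SectorConfig 2 2) :=
    funext fun κ => Prod.ext (he κ).1 (he κ).2
  rw [hval]
  refine Continuous.prodMk (continuous_pi fun i => ?_) (continuous_pi fun i => ?_)
  · fin_cases i
    · exact continuous_fst
    · exact continuous_fst.comp continuous_snd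
  · fin_cases i
    · exact continuous_snd.comp continuous_snd
    · exact (continuous_fst.add (continuous_fst.comp continuous_snd)).sub (continuous_snd.comp continuous_snd)

/-! ### The pair sector -/

/-- **The pair sector (W2–W4 of stub KT, shell form).** For `ω₂ > 0` with the odd-sector gap and a
continuous kernel `G` on the pair shell whose distance to the rigid model `A·i·[sin]·Φ/∏ω` (`A ≠ 0`) is
controlled by the free frequency, `‖G − A i [sin] Φ/∏ω‖ ≤ C|Ω₂₂|`, the push-forward of `|G|² σ₂₂` under
`Ω₂₂ = sectorPhase ω₂` has on a window `(−δ, δ)` a continuous density `ρ ≥ 0` with `ρ(0) > 0`.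
Transport to the cell (`forceWindow_pairTransport`), slab domination and comparison of the transported
weight (bracket moduli of `sin` and `ω`), generalised threshold continuity (`forceWindow_thresholdContinuous`)
and positivity (`forceWindow_density_pos_of_window`). [folklore] -/
theorem forceWindow_pairSector_of {ω₂ a b : ℝ} (hω : 0 < ω₂) (hgap : HasOddSectorGap ω₂ a b)
    {G : Shell 2 2 → ℂ} (hG : Continuous G) {A C : ℝ} (hA : A ≠ 0)
    (hβ : ∀ κ : Shell 2 2,
      ‖G κ - (A : ℂ) * Complex.I *
          ((sinT ((κ : SectorConfig 2 2).1 0) + sinT ((κ : SectorConfig 2 2).1 1) -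
              sinT ((κ : SectorConfig 2 2).2 0) - sinT ((κ : SectorConfig 2 2).2 1) : ℝ) : ℂ) *
          (PinnedChainKinetic.vertex a b
              ((κ : SectorConfig 2 2).1 0, (κ : SectorConfig 2 2).1 1, (κ : SectorConfig 2 2).2 0) : ℂ) /
          ((PinnedChainKinetic.dispersion ω₂ ((κ : SectorConfig 2 2).1 0) *
              PinnedChainKinetic.dispersion ω₂ ((κ : SectorConfig 2 2).1 1) *
              PinnedChainKinetic.dispersion ω₂ ((κ : SectorConfig 2 2).2 0) *
              PinnedChainKinetic.dispersion ω₂ ((κ : SectorConfig 2 2).2 1) : ℝ) : ℂ)‖ ≤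
        C * |sectorPhase ω₂ κ|) :
    ∃ δ : ℝ, 0 < δ ∧ ∃ ρ : ℝ → ℝ, ContinuousOn ρ (Set.Ioo (-δ) δ) ∧ (∀ x ∈ Set.Ioo (-δ) δ, 0 ≤ ρ x) ∧ 0 < ρ 0 ∧
      (Measure.map (sectorPhase ω₂) ((shellMeasure 2 2).withDensity (fun κ => ENNReal.ofReal (‖G κ‖ ^ 2)))).restrict
          (Set.Ioo (-δ) δ) = (volume.restrict (Set.Ioo (-δ) δ)).withDensity (fun x => ENNReal.ofReal (ρ x)) := by
  obtain ⟨e, he, htr⟩ := forceWindow_pairTransport ω₂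
  have hec : Continuous e := forceWindow_continuous_pairShell he
  have hlift : Continuous fun p : ℝ × ℝ × ℝ => ((((p.1 : ℝ) : 𝕋), (((p.2.2 : ℝ) : 𝕋), ((p.2.1 : ℝ) : 𝕋))) : 𝕋3) := by
    fun_prop
  -- `C ≥ 0` without loss of generality
  have hβ₀ : ∀ κ : Shell 2 2, _ ≤ max C 0 * |sectorPhase ω₂ κ| := fun κ =>
    (hβ κ).trans (mul_le_mul_of_nonneg_right (le_max_left _ _) (abs_nonneg _))
  have hC₀ : 0 ≤ max C 0 := le_max_right _ _
  have hβ' := forceWindow_pair_hypothesis_real he hβ₀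
  -- the bracket moduli of `sin` and `ω`
  obtain ⟨Ks, hKs0, hKs⟩ := stub_bracketModulus Real.sin Real.sin_periodic Real.contDiff_sin
  obtain ⟨Kω, hKω0, hKω⟩ := forceWindow_resonanceFn_le hω
  have hWsin : ∀ p : ℝ × ℝ × ℝ, vertex a b p.1 p.2.2 p.2.1 ^ 2 /
      (dispersion ω₂ p.1 * dispersion ω₂ p.2.2 * dispersion ω₂ p.2.1 * dispersion ω₂ (p.1 + p.2.2 - p.2.1)) ^ 2 *
      (Real.sin p.1 + Real.sin p.2.2 - Real.sin p.2.1 - Real.sin (p.1 + p.2.2 - p.2.1)) ^ 2 ≤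
      (|a| + 16 * |b|) ^ 2 * Ks ^ 2 / ω₂ ^ 4 *
        (Real.sin ((p.2.1 - p.1) / 2) ^ 2 * Real.sin ((p.2.2 - p.2.1) / 2) ^ 2) := fun p =>
    slabFibre_weight_le hω a b hKs0 hKs p.1 p.2.2 p.2.1
  have hs1 : ∀ p : ℝ × ℝ × ℝ, Real.sin ((p.2.1 - p.1) / 2) ^ 2 * Real.sin ((p.2.2 - p.2.1) / 2) ^ 2 ≤ 1 := by
    intro p
    have h1 : Real.sin ((p.2.1 - p.1) / 2) ^ 2 ≤ 1 := by
      rw [← sq_abs]; nlinarith [Real.abs_sin_le_one ((p.2.1 - p.1) / 2), abs_nonneg (Real.sin ((p.2.1 - p.1) / 2))]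
    have h2 : Real.sin ((p.2.2 - p.2.1) / 2) ^ 2 ≤ 1 := by
      rw [← sq_abs]; nlinarith [Real.abs_sin_le_one ((p.2.2 - p.2.1) / 2), abs_nonneg (Real.sin ((p.2.2 - p.2.1) / 2))]
    nlinarith [sq_nonneg (Real.sin ((p.2.1 - p.1) / 2)), sq_nonneg (Real.sin ((p.2.2 - p.2.1) / 2))]
  have hΩsq : ∀ p : ℝ × ℝ × ℝ, resonanceFn ω₂ p.1 p.2.2 p.2.1 ^ 2 ≤
      Kω ^ 2 * (Real.sin ((p.2.1 - p.1) / 2) ^ 2 * Real.sin ((p.2.2 - p.2.1) / 2) ^ 2) := by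
    intro p
    have h := hKω p.1 p.2.2 p.2.1
    have h0 : 0 ≤ Kω * |Real.sin ((p.2.1 - p.1) / 2) * Real.sin ((p.2.2 - p.2.1) / 2)| := by positivity
    calc resonanceFn ω₂ p.1 p.2.2 p.2.1 ^ 2 = |resonanceFn ω₂ p.1 p.2.2 p.2.1| ^ 2 := (sq_abs _).symm
      _ ≤ (Kω * |Real.sin ((p.2.1 - p.1) / 2) * Real.sin ((p.2.2 - p.2.1) / 2)|) ^ 2 :=
          pow_le_pow_left₀ (abs_nonneg _) h 2
      _ = Kω ^ 2 * (Real.sin ((p.2.1 - p.1) / 2) ^ 2 * Real.sin ((p.2.2 - p.2.1) / 2) ^ 2) := by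
          rw [mul_pow, sq_abs]; ring
  have hΩabs : ∀ p : ℝ × ℝ × ℝ, |resonanceFn ω₂ p.1 p.2.2 p.2.1| ≤ Kω := fun p =>
    (hKω p.1 p.2.2 p.2.1).trans (by
      have : |Real.sin ((p.2.1 - p.1) / 2) * Real.sin ((p.2.2 - p.2.1) / 2)| ≤ 1 := by
        rw [abs_mul]
        exact mul_le_one₀ (Real.abs_sin_le_one _) (abs_nonneg _) (Real.abs_sin_le_one _)
      nlinarith)
  -- the transported weight
  have hWc : Continuous fun p : ℝ × ℝ × ℝ =>
      ‖G (e (((p.1 : ℝ) : 𝕋), (((p.2.2 : ℝ) : 𝕋), ((p.2.1 : ℝ) : 𝕋))))‖ ^ 2 :=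
    (continuous_norm.comp (hG.comp (hec.comp hlift))).pow 2
  have hW0 : ∀ p : ℝ × ℝ × ℝ, 0 ≤ ‖G (e (((p.1 : ℝ) : 𝕋), (((p.2.2 : ℝ) : 𝕋), ((p.2.1 : ℝ) : 𝕋))))‖ ^ 2 :=
    fun p => sq_nonneg _
  -- norm of the model term
  have hT : ∀ p : ℝ × ℝ × ℝ, ‖(A : ℂ) * Complex.I *
      ((Real.sin p.1 + Real.sin p.2.2 - Real.sin p.2.1 - Real.sin (p.1 + p.2.2 - p.2.1) : ℝ) : ℂ) *
      (vertex a b p.1 p.2.2 p.2.1 : ℂ) /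
      ((dispersion ω₂ p.1 * dispersion ω₂ p.2.2 * dispersion ω₂ p.2.1 * dispersion ω₂ (p.1 + p.2.2 - p.2.1) : ℝ) : ℂ)‖ ^ 2 =
      A ^ 2 * (vertex a b p.1 p.2.2 p.2.1 ^ 2 /
        (dispersion ω₂ p.1 * dispersion ω₂ p.2.2 * dispersion ω₂ p.2.1 * dispersion ω₂ (p.1 + p.2.2 - p.2.1)) ^ 2 *
        (Real.sin p.1 + Real.sin p.2.2 - Real.sin p.2.1 - Real.sin (p.1 + p.2.2 - p.2.1)) ^ 2) := fun p =>
    forceWindow_norm_model_sq _ _ _ _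
  -- slab domination
  have hCw : 0 ≤ 2 * A ^ 2 * ((|a| + 16 * |b|) ^ 2 * Ks ^ 2 / ω₂ ^ 4) + 2 * (max C 0) ^ 2 * Kω ^ 2 := by positivity
  have hdom : ∀ p : ℝ × ℝ × ℝ, ‖G (e (((p.1 : ℝ) : 𝕋), (((p.2.2 : ℝ) : 𝕋), ((p.2.1 : ℝ) : 𝕋))))‖ ^ 2 ≤
      (2 * A ^ 2 * ((|a| + 16 * |b|) ^ 2 * Ks ^ 2 / ω₂ ^ 4) + 2 * (max C 0) ^ 2 * Kω ^ 2) *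
        Real.sin ((p.2.1 - p.1) / 2) ^ 2 * Real.sin ((p.2.2 - p.2.1) / 2) ^ 2 := by
    intro p
    have h1 := (forceWindow_norm_sq_bounds _ _ (hβ' p)).1
    rw [hT p] at h1
    have h2 := hWsin p
    have h3 := hΩsq p
    have hA2 : 0 ≤ A ^ 2 := sq_nonneg _
    have hC2 : 0 ≤ (max C 0) ^ 2 := sq_nonneg _
    nlinarith [mul_le_mul_of_nonneg_left h2 hA2, mul_le_mul_of_nonneg_left h3 hC2, mul_pow (max C 0) (|resonanceFn ω₂ p.1 p.2.2 p.2.1|) 2,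
      sq_abs (resonanceFn ω₂ p.1 p.2.2 p.2.1)]
  -- comparison with the rigid weight
  have hTle : ∀ p : ℝ × ℝ × ℝ, ‖(A : ℂ) * Complex.I *
      ((Real.sin p.1 + Real.sin p.2.2 - Real.sin p.2.1 - Real.sin (p.1 + p.2.2 - p.2.1) : ℝ) : ℂ) *
      (vertex a b p.1 p.2.2 p.2.1 : ℂ) /
      ((dispersion ω₂ p.1 * dispersion ω₂ p.2.2 * dispersion ω₂ p.2.1 * dispersion ω₂ (p.1 + p.2.2 - p.2.1) : ℝ) : ℂ)‖ ≤
      Real.sqrt (A ^ 2 * ((|a| + 16 * |b|) ^ 2 * Ks ^ 2 / ω₂ ^ 4)) := by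
    intro p
    rw [← Real.sqrt_sq (norm_nonneg _), hT p]
    refine Real.sqrt_le_sqrt (mul_le_mul_of_nonneg_left ((hWsin p).trans ?_) (sq_nonneg A))
    exact mul_le_of_le_one_right (by positivity) (hs1 p)
  have hcmp : ∀ p : ℝ × ℝ × ℝ, |‖G (e (((p.1 : ℝ) : 𝕋), (((p.2.2 : ℝ) : 𝕋), ((p.2.1 : ℝ) : 𝕋))))‖ ^ 2 -
      A ^ 2 * (vertex a b p.1 p.2.2 p.2.1 ^ 2 /
        (dispersion ω₂ p.1 * dispersion ω₂ p.2.2 * dispersion ω₂ p.2.1 * dispersion ω₂ (p.1 + p.2.2 - p.2.1)) ^ 2 *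
        (Real.sin p.1 + Real.sin p.2.2 - Real.sin p.2.1 - Real.sin (p.1 + p.2.2 - p.2.1)) ^ 2)| ≤
      (max C 0 * (max C 0 * Kω + 2 * Real.sqrt (A ^ 2 * ((|a| + 16 * |b|) ^ 2 * Ks ^ 2 / ω₂ ^ 4)))) *
        |resonanceFn ω₂ p.1 p.2.2 p.2.1| := by
    intro p
    have h1 := (forceWindow_norm_sq_bounds _ _ (hβ' p)).2
    rw [hT p] at h1
    refine h1.trans ((mul_le_mul_of_nonneg_left (add_le_add (mul_le_mul_of_nonneg_left (hΩabs p) hC₀)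
      (mul_le_mul_of_nonneg_left (hTle p) zero_le_two)) (by positivity)).trans_eq (by ring))
  -- continuity window and positivity on the cell
  obtain ⟨δ, hδ, ρ, hρc, hρ0, hwin⟩ := forceWindow_thresholdContinuous hω hCw hWc hW0
    (fun p => by dsimp only; rw [AddCircle.coe_add_period])
    (fun p => by dsimp only; rw [AddCircle.coe_add_period])
    (fun p => by dsimp only; rw [AddCircle.coe_add_period]) hdom
  have hpos := forceWindow_density_pos_of_window hω hgap hWc hW0 (by positivity : 0 < A ^ 2) hcmp hδ hρc hρ0 hwin
  -- back to the shell
  have hg : Measurable fun κ : Shell 2 2 => ENNReal.ofReal (‖G κ‖ ^ 2) :=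
    ((continuous_norm.comp hG).pow 2).measurable.ennreal_ofReal
  have hM : Measure.map (sectorPhase ω₂) ((shellMeasure 2 2).withDensity (fun κ => ENNReal.ofReal (‖G κ‖ ^ 2))) =
      (ENNReal.ofReal (2 * Real.pi) ^ 3)⁻¹ •
        Measure.map (fun p : ℝ × ℝ × ℝ => resonanceFn ω₂ p.1 p.2.2 p.2.1)
          (((volume.restrict (Ioc (-Real.pi) Real.pi)).prod ((volume.restrict (Ioc (-Real.pi) Real.pi)).prod
            (volume.restrict (Ioc (-Real.pi) Real.pi)))).withDensity
            (fun p : ℝ × ℝ × ℝ => ENNReal.ofReal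
              (‖G (e (((p.1 : ℝ) : 𝕋), (((p.2.2 : ℝ) : 𝕋), ((p.2.1 : ℝ) : 𝕋))))‖ ^ 2))) := htr _ hg
  have hne : (ENNReal.ofReal (2 * Real.pi) ^ 3 : ℝ≥0∞)⁻¹ ≠ ⊤ :=
    ENNReal.inv_ne_top.2 (pow_ne_zero _ ((ENNReal.ofReal_pos.2 Real.two_pi_pos).ne'))
  have hinv : (ENNReal.ofReal (2 * Real.pi) ^ 3 : ℝ≥0∞)⁻¹ = ENNReal.ofReal (((2 * Real.pi) ^ 3)⁻¹) := by
    rw [← ENNReal.ofReal_pow Real.two_pi_pos.le, ENNReal.ofReal_inv_of_pos (by positivity)]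
  refine ⟨δ, hδ, fun x => ((2 * Real.pi) ^ 3)⁻¹ * ρ x, continuousOn_const.mul hρc,
    fun x hx => mul_nonneg (by positivity) (hρ0 x hx), mul_pos (by positivity) hpos, ?_⟩
  rw [hM, Measure.restrict_smul, hwin, ← withDensity_smul' _ _ hne]
  congr 1
  funext x
  rw [Pi.smul_apply, smul_eq_mul, hinv, ← ENNReal.ofReal_mul (by positivity)]


/-- **Registered helper (stub KT, part IV): the pair sector.** For `ω₂ > 0` with the odd-sector gap
and a continuous kernel `G` on the pair shell with `‖G − A i [sin] Φ/∏ω‖ ≤ C|Ω₂₂|` (`A ≠ 0`), the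
push-forward of `|G|² σ₂₂` under the free frequency `Ω₂₂ = sectorPhase ω₂` has on a window `(−δ, δ)` a
continuous density `ρ ≥ 0` with `ρ(0) > 0` — `forceWindow_pairSector_of` in the registered `∀`-form.
[folklore] -/
theorem forceWindow_pairSector : ∀ ω₂ a b : ℝ, 0 < ω₂ → Literature.MathematicalPhysics.KineticTheory.PhononBoltzmann.HasOddSectorGap ω₂ a b → ∀ (G : Literature.MathematicalPhysics.KineticTheory.HeatConduction.HarmonicChaos.Shell 2 2 → ℂ) (A C : ℝ), Continuous G → A ≠ 0 → (∀ κ : Literature.MathematicalPhysics.KineticTheory.HeatConduction.HarmonicChaos.Shell 2 2, ‖G κ - (A : ℂ) * Complex.I * ((Literature.MathematicalPhysics.KineticTheory.HeatConduction.PinnedChainKinetic.sinT ((κ : Literature.MathematicalPhysics.KineticTheory.HeatConduction.HarmonicChaos.SectorConfig 2 2).1 0) + Literature.MathematicalPhysics.KineticTheory.HeatConduction.PinnedChainKinetic.sinT ((κ : Literature.MathematicalPhysics.KineticTheory.HeatConduction.HarmonicChaos.SectorConfig 2 2).1 1) - Literature.MathematicalPhysics.KineticTheory.HeatConduction.PinnedChainKinetic.sinT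 ((κ : Literature.MathematicalPhysics.KineticTheory.HeatConduction.HarmonicChaos.SectorConfig 2 2).2 0) - Literature.MathematicalPhysics.KineticTheory.HeatConduction.PinnedChainKinetic.sinT ((κ : Literature.MathematicalPhysics.KineticTheory.HeatConduction.HarmonicChaos.SectorConfig 2 2).2 1) : ℝ) : ℂ) * (Literature.MathematicalPhysics.KineticTheory.HeatConduction.PinnedChainKinetic.vertex a b ((κ : Literature.MathematicalPhysics.KineticTheory.HeatConduction.HarmonicChaos.SectorConfig 2 2).1 0, (κ : Literature.MathematicalPhysics.KineticTheory.HeatConduction.HarmonicChaos.SectorConfig 2 2).1 1, (κ : Literature.MathematicalPhysics.KineticTheory.HeatConduction.HarmonicChaos.SectorConfig 2 2).2 0) : ℂ) / ((Literature.MathematicalPhysics.KineticTheory.HeatConduction.PinnedChainKinetic.dispersion ω₂ ((κ : Literature.MathematicalPhysics.KineticTheory.HeatConduction.HarmonicChaos.SectorConfig 2 2).1 0) * Literature.MathematicalPhysics.KineticTheory.HeatConduction.PinnedChainKinetic.dispersion ω₂ ((κ : Literature.MathematicalPhysics.KineticTheory.HeatConduction.HarmonicChaos.SectorConfig 2 2).1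 1) * Literature.MathematicalPhysics.KineticTheory.HeatConduction.PinnedChainKinetic.dispersion ω₂ ((κ : Literature.MathematicalPhysics.KineticTheory.HeatConduction.HarmonicChaos.SectorConfig 2 2).2 0) * Literature.MathematicalPhysics.KineticTheory.HeatConduction.PinnedChainKinetic.dispersion ω₂ ((κ : Literature.MathematicalPhysics.KineticTheory.HeatConduction.HarmonicChaos.SectorConfig 2 2).2 1) : ℝ) : ℂ)‖ ≤ C * |Literature.MathematicalPhysics.KineticTheory.HeatConduction.HarmonicChaos.sectorPhase ω₂ κ|) → ∃ δ : ℝ, 0 < δ ∧ ∃ ρ : ℝ → ℝ, ContinuousOn ρ (Set.Ioo (-δ) δ) ∧ (∀ x ∈ Set.Ioo (-δ) δ, 0 ≤ ρ x) ∧ 0 < ρ 0 ∧ (MeasureTheory.Measure.map (Literature.MathematicalPhysics.KineticTheory.HeatConduction.HarmonicChaos.sectorPhase ω₂) ((Literature.MathematicalPhysics.KineticTheory.HeatConduction.HarmonicChaos.shellMeasure 2 2).withDensity (fun κ => ENNReal.ofReal (‖G κ‖ ^ 2)))).restrict (Set.Ioo (-δ) δ) = (MeasureTheory.volume.restrict (Set.Ioo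 (-δ) δ)).withDensity (fun x => ENNReal.ofReal (ρ x)) :=
  fun _ _ _ hω hgap _ _ _ hG hA hβ => forceWindow_pairSector_of hω hgap hG hA hβ

end Summit.AtomisticToContinuum.FouriersLaw.Theorems.DrudeDissolution.GramPencilHarmonicChaos

end
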